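import Literature.MathematicalPhysics.QuantumLattice.LiebSpinReflection
import Literature.MathematicalPhysics.QuantumLattice.FinDimSpectrumProofs
import HarnessLib
/-!
# Lieb's spin-space reflection positivity: ground-space packaging and irreducibility

Trunk T-QLATTICE, family `hubbard`. Companion to `LiebSpinReflection` (E. H. Lieb, *Two
theorems on the Hubbard model*, Phys. Rev. Lett. **62** (1989) 1201, proof of Theorem 1(b); read in
the reprint A. Montorsi (ed.), *The Hubbard Model*, pp. 111–119 of `book:editornd-hubbard-model`).
That file proves Lieb's matrix lemma under the hypothesis structure `Literature.Hubbard.IsLiebSystem K L U E`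
(Hermitian `K`, `L_x`; `U < 0`; `E` a lower bound of the quadratic form of
`𝓗 W = KW + WK + U Σ_x L_x W L_x`; irreducibility of `{K, L_x}`) and concludes
`IsLiebSystem.exists_posDef_eq_smul` / `IsLiebSystem.exists_eq_smul`. This file supplies, for
`K = T` real symmetric and real **diagonal** `L_k = rdiag (L k)`:

* the packaging of `𝓗` as a Hermitian matrix `liebMatrix T L U` on `X × X` acting on `Matrix.vec W`
  (`liebMatrix_mulVec_vec`), so that `Matrix.groundEnergy` / `Matrix.groundSpace` of
  `FinDimSpectrum` apply; `E := groundEnergy (liebMatrix T L U)` then satisfies the energy bound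
  (`energy_le`, the variational principle `posSemidef_sub_groundEnergy`), and ground states of the
  matrix are exactly the solutions of Lieb's eq. (4) (`mem_groundSpace_iff_liebOp`);
* irreducibility from two checkable hypotheses (`eq_bot_or_eq_top`): the diagonal family
  separates the points of `X` (`hsep`; Lieb's projectors `L^α = Π_{x∈α} L_x` onto basis vectors)
  and the graph `{T a b ≠ 0}` on `X` is connected (`hconn`; "since `Λ` is connected by `T` … the
  `α`'s are connected by `K`") — a subspace stable under the `L_k` is a coordinate subspace
  (`single_mem_of_mem`), and one stable under `T` as well is then `⊥` or `⊤`;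
* the resulting `isLiebSystem` and the form consumed by the proof of Theorem 2
  (`HubbardHalfFilledSector`): `exists_posDef_groundState_unique` — the ground space of
  `liebMatrix T L U` is a line spanned by `vec W₀` with `W₀` positive definite.

Everything lives in the namespace `Literature.QLattice.SpinReflection`; the lemma itself is not
re-proved here.
-/

noncomputable section

open Matrix
open scoped ComplexOrder MatrixOrder Kronecker

namespace Literature.MathematicalPhysics.QuantumLattice.SpinReflection

variable {X : Type*} [Fintype X] [DecidableEq X] {K : Type*} [Fintype K]

/-- The real diagonal matrix `diag (l a)` viewed as a complex matrix; Lieb's `L_x`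
(`(L_x)_{αβ} = ⟨ψ^β|n_x|ψ^α⟩`, diagonal in the site basis) are of this form. [cite: LiebPRL1989, proof of Theorem 1] -/
def rdiag (l : X → ℝ) : Matrix X X ℂ := diagonal fun a => ((l a : ℝ) : ℂ)

omit [Fintype X] in
/-- A real diagonal matrix is Hermitian. [folklore] -/
theorem rdiag_conjTranspose (l : X → ℝ) : (rdiag l)ᴴ = rdiag l := by
  simp [rdiag, diagonal_conjTranspose, Pi.star_def]

omit [Fintype X] in
/-- A diagonal matrix is symmetric. [folklore] -/
theorem rdiag_transpose (l : X → ℝ) : (rdiag l)ᵀ = rdiag l := by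
  simp [rdiag, diagonal_transpose]

/-- A diagonal matrix acts coordinatewise. [folklore] -/
theorem rdiag_mulVec (l : X → ℝ) (x : X → ℂ) : rdiag l *ᵥ x = fun i => (l i : ℂ) * x i := by
  ext i; simp [rdiag, mulVec_diagonal]

/-- Lieb's operator `W ↦ TW + WT + U Σ_k L_k W L_k` (`Literature.MathematicalPhysics.QuantumLattice.liebOp` with diagonal `L_k`)
written as an honest matrix on `X × X` acting on `Matrix.vec W` (see `liebMatrix_mulVec_vec`):
`1 ⊗ T + T ⊗ 1 + U Σ_k L_k ⊗ L_k`. [cite: LiebPRL1989, eq. (4)] -/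
def liebMatrix (T : Matrix X X ℂ) (L : K → X → ℝ) (U : ℝ) : Matrix (X × X) (X × X) ℂ :=
  (1 : Matrix X X ℂ) ⊗ₖ T + T ⊗ₖ (1 : Matrix X X ℂ) + (U : ℂ) • ∑ k, (rdiag (L k) ⊗ₖ rdiag (L k))

/-- `liebMatrix` acts on `vec W` as Lieb's operator acts on `W` (uses `T = Tᵀ`). [cite: LiebPRL1989, eq. (4)] -/
theorem liebMatrix_mulVec_vec {T : Matrix X X ℂ} (hT : T.IsSymm) (L : K → X → ℝ) (U : ℝ)
    (W : Matrix X X ℂ) :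
    liebMatrix T L U *ᵥ vec W = vec (Literature.MathematicalPhysics.QuantumLattice.liebOp T (fun k => rdiag (L k)) U W) := by
  simp only [liebMatrix, Literature.MathematicalPhysics.QuantumLattice.liebOp, add_mulVec, kronecker_mulVec_vec, transpose_one,
    mul_one, one_mul, hT.eq, vec_add]
  congr 1
  rw [smul_mulVec, Matrix.sum_mulVec, vec_smul, vec_sum]
  congr 1
  refine Finset.sum_congr rfl fun k _ => ?_
  rw [kronecker_mulVec_vec, rdiag_transpose]

omit [Fintype X] in
/-- For `T` Hermitian and real `L`, `U`, the Lieb matrix is Hermitian. [folklore] -/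
theorem liebMatrix_isHermitian {T : Matrix X X ℂ} (hT : T.IsHermitian) (L : K → X → ℝ) (U : ℝ) :
    (liebMatrix T L U).IsHermitian := by
  unfold liebMatrix
  refine IsHermitian.add (IsHermitian.add ?_ ?_) ?_
  · rw [IsHermitian, conjTranspose_kronecker, conjTranspose_one, hT.eq]
  · rw [IsHermitian, conjTranspose_kronecker, conjTranspose_one, hT.eq]
  · rw [IsHermitian, conjTranspose_smul, conjTranspose_sum, Complex.star_def, Complex.conj_ofReal]
    congr 1
    refine Finset.sum_congr rfl fun k _ => ?_
    rw [conjTranspose_kronecker, rdiag_conjTranspose]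

/-- The quadratic form of the Lieb matrix is Lieb's energy functional:
`⟨vec W, 𝕄 vec W⟩ = ⟨W, 𝓗 W⟩_{HS} = Tr (Wᴴ 𝓗(W))`. [cite: LiebPRL1989, eq. (3)] -/
theorem form_eq_hsInner {T : Matrix X X ℂ} (hT : T.IsSymm) (L : K → X → ℝ) (U : ℝ) (W : Matrix X X ℂ) :
    star (vec W) ⬝ᵥ (liebMatrix T L U *ᵥ vec W) =
      Literature.MathematicalPhysics.QuantumLattice.hsInner W (Literature.MathematicalPhysics.QuantumLattice.liebOp T (fun k => rdiag (L k)) U W) := by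
  rw [liebMatrix_mulVec_vec hT, star_vec_dotProduct_vec]; rfl

omit [DecidableEq X] in
/-- `⟨vec W, vec W⟩ = ⟨W, W⟩_{HS}` ("`⟨ψ|ψ⟩ = Σ |W_αβ|² = Tr W²`"). [cite: LiebPRL1989, proof of Theorem 1] -/
theorem norm_eq_hsInner (W : Matrix X X ℂ) : star (vec W) ⬝ᵥ vec W = Literature.MathematicalPhysics.QuantumLattice.hsInner W W :=
  star_vec_dotProduct_vec W W

/-- Ground states of the Lieb matrix are exactly the solutions of Lieb's eigenvalue equation (4)
with `e` the lowest eigenvalue. [cite: LiebPRL1989, eq. (4)] -/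
theorem mem_groundSpace_iff_liebOp {T : Matrix X X ℂ} (hT : T.IsSymm) (L : K → X → ℝ) (U : ℝ)
    (W : Matrix X X ℂ) :
    vec W ∈ (liebMatrix T L U).groundSpace ↔
      Literature.MathematicalPhysics.QuantumLattice.liebOp T (fun k => rdiag (L k)) U W = ((liebMatrix T L U).groundEnergy : ℂ) • W := by
  rw [Matrix.mem_groundSpace_iff, liebMatrix_mulVec_vec hT, ← vec_smul, vec_inj]

/-- The energy bound of `IsLiebSystem` for `E = E₀(𝕄)`: `E₀ ⟨Z,Z⟩ ≤ Re ⟨Z, 𝓗 Z⟩`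
(variational principle, `𝕄 - E₀ ≥ 0`). [folklore] -/
theorem energy_le {T : Matrix X X ℂ} (hT : T.IsHermitian ∧ T.IsSymm) (L : K → X → ℝ) (U : ℝ)
    (Z : Matrix X X ℂ) :
    (liebMatrix T L U).groundEnergy * (Literature.MathematicalPhysics.QuantumLattice.hsInner Z Z).re ≤
      (Literature.MathematicalPhysics.QuantumLattice.hsInner Z (Literature.MathematicalPhysics.QuantumLattice.liebOp T (fun k => rdiag (L k)) U Z)).re := by
  have h := (Matrix.posSemidef_sub_groundEnergy (liebMatrix_isHermitian hT.1 L U)).dotProduct_mulVec_nonneg (vec Z)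
  rw [sub_mulVec, dotProduct_sub, Algebra.algebraMap_eq_smul_one, smul_mulVec, one_mulVec,
    dotProduct_smul, Complex.real_smul, form_eq_hsInner hT.2, norm_eq_hsInner] at h
  obtain ⟨hre, -⟩ := Complex.nonneg_iff.mp h
  rw [Complex.sub_re, Complex.re_ofReal_mul] at hre
  linarith

/-! ### Irreducibility from a separating diagonal family and a connected `T`-graph -/

omit [Fintype K] in
/-- A subspace stable under a separating family of diagonal matrices is a coordinate subspace:
if `x ∈ Q` and `x a ≠ 0` then the basis vector `μ^a ∈ Q` (multiply `x` by the polynomial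
`Π_b (L_{k_b} - L_{k_b}(b))`, which stays in `Q`; Lieb uses the projectors `L^α = Π_x L_x`).
[cite: LiebPRL1989, proof of Theorem 1(b)] -/
theorem single_mem_of_mem {L : K → X → ℝ} (hsep : ∀ a b : X, a ≠ b → ∃ k, L k a ≠ L k b)
    {Q : Submodule ℂ (X → ℂ)} (hL : ∀ k, ∀ y ∈ Q, rdiag (L k) *ᵥ y ∈ Q)
    {x : X → ℂ} (hx : x ∈ Q) {a : X} (ha : x a ≠ 0) : (Pi.single a 1 : X → ℂ) ∈ Q := by
  have key : ∀ s : Finset X, a ∉ s → ∃ d : X → ℂ, d a ≠ 0 ∧ (∀ b ∈ s, d b = 0) ∧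
      (fun i => d i * x i) ∈ Q := by
    intro s
    induction s using Finset.induction_on with
    | empty => exact fun _ => ⟨fun _ => 1, one_ne_zero, fun b hb => absurd hb (by simp), by simpa⟩
    | insert b s hb ih =>
      intro has
      rw [Finset.mem_insert, not_or] at has
      obtain ⟨d, hda, hds, hdQ⟩ := ih has.2
      obtain ⟨k, hk⟩ := hsep a b has.1
      refine ⟨fun i => ((L k i : ℂ) - L k b) * d i, ?_, ?_, ?_⟩
      · exact mul_ne_zero (sub_ne_zero.2 (by exact_mod_cast hk)) hda
      · intro b' hb'
        rcases Finset.mem_insert.1 hb' with rfl | hb'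
        · simp
        · simp [hds b' hb']
      · have h1 := hL k _ hdQ
        rw [rdiag_mulVec] at h1
        have h2 : (fun i => ((L k i : ℂ) - L k b) * d i * x i) =
            (fun i => (L k i : ℂ) * (d i * x i)) - (L k b : ℂ) • (fun i => d i * x i) := by
          ext i
          simp only [Pi.sub_apply, Pi.smul_apply, smul_eq_mul]
          ring
        simp only [mul_assoc] at h2 ⊢
        rw [h2]
        exact Q.sub_mem h1 (Q.smul_mem _ hdQ)
  obtain ⟨d, hda, hds, hdQ⟩ := key (Finset.univ.erase a) (by simp)
  have hdx : (fun i => d i * x i) = (d a * x a) • (Pi.single a 1 : X → ℂ) := by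
    ext i
    by_cases hi : i = a
    · subst hi; simp
    · simp [hi, hds i (by simp [hi])]
  rw [hdx] at hdQ
  have h := Q.smul_mem (d a * x a)⁻¹ hdQ
  rwa [smul_smul, inv_mul_cancel₀ (mul_ne_zero hda ha), one_smul] at h

omit [Fintype K] in
/-- **Irreducibility** ("`Q` is either just the zero vector or else every vector is in `Q`"): a
subspace stable under `T` and under a separating diagonal family `L_k` is `⊥` or `⊤` when the
graph `{T a b ≠ 0}` on `X` is connected (`T` symmetric). [cite: LiebPRL1989, proof of Theorem 1(b)] -/
theorem eq_bot_or_eq_top {T : Matrix X X ℂ} (hT : T.IsSymm) {L : K → X → ℝ}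
    (hsep : ∀ a b : X, a ≠ b → ∃ k, L k a ≠ L k b)
    (hconn : ∀ S : Set X, (∃ a, a ∈ S) → (∃ b, b ∉ S) → ∃ a ∈ S, ∃ b ∉ S, T a b ≠ 0)
    (Q : Submodule ℂ (X → ℂ)) (hK : ∀ v ∈ Q, T *ᵥ v ∈ Q)
    (hL : ∀ k, ∀ v ∈ Q, rdiag (L k) *ᵥ v ∈ Q) : Q = ⊥ ∨ Q = ⊤ := by
  by_cases hQ : Q = ⊥
  · exact Or.inl hQ
  right
  obtain ⟨x, hx, hx0⟩ := (Submodule.ne_bot_iff Q).1 hQ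
  obtain ⟨a, ha⟩ : ∃ a, x a ≠ 0 := by
    by_contra h
    push Not at h
    exact hx0 (funext h)
  set S : Set X := {b | (Pi.single b 1 : X → ℂ) ∈ Q} with hS
  have haS : a ∈ S := single_mem_of_mem hsep hL hx ha
  have hclosed : ∀ b ∈ S, ∀ c, T b c ≠ 0 → c ∈ S := by
    intro b hb c hbc
    have hTb : T *ᵥ Pi.single b 1 ∈ Q := hK _ hb
    refine single_mem_of_mem hsep hL hTb (a := c) ?_
    rw [mulVec_single_one]
    simp only [col_apply, ne_eq]
    exact fun h => hbc ((hT.apply c b).trans h)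
  have hall : ∀ b, b ∈ S := by
    by_contra h
    push Not at h
    obtain ⟨b, hb, c, hc, hbc⟩ := hconn S ⟨a, haS⟩ h
    exact hc (hclosed b hb c hbc)
  rw [Submodule.eq_top_iff']
  intro v
  rw [← Finset.univ_sum_single v]
  refine Q.sum_mem fun b _ => ?_
  have h : (Pi.single b (v b) : X → ℂ) = v b • (Pi.single b 1 : X → ℂ) := by
    ext i; by_cases hi : i = b <;> simp [hi]
  rw [h]
  exact Q.smul_mem _ (hall b)

/-- The hypotheses of `Literature.MathematicalPhysics.QuantumLattice.IsLiebSystem` for real symmetric `T`, coupling `U < 0`,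
separating real diagonal `L_k`, connected `T`-graph, and `E` the lowest eigenvalue of the Lieb
matrix. [cite: LiebPRL1989, proof of Theorem 1(b)] -/
theorem isLiebSystem {T : Matrix X X ℂ} (hT : T.IsHermitian ∧ T.IsSymm) {U : ℝ} (hU : U < 0)
    {L : K → X → ℝ} (hsep : ∀ a b : X, a ≠ b → ∃ k, L k a ≠ L k b)
    (hconn : ∀ S : Set X, (∃ a, a ∈ S) → (∃ b, b ∉ S) → ∃ a ∈ S, ∃ b ∉ S, T a b ≠ 0) :
    Literature.MathematicalPhysics.QuantumLattice.IsLiebSystem T (fun k => rdiag (L k)) U (liebMatrix T L U).groundEnergy where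
  K_herm := hT.1.eq
  L_herm k := rdiag_conjTranspose (L k)
  U_neg := hU
  energy_le Z := energy_le hT L U Z
  irred Q hK hL := eq_bot_or_eq_top hT.2 hsep hconn Q hK hL

/-- **Lieb's lemma, ground-space form.** For `T` real symmetric with connected graph on `X`,
coupling `U < 0` and a separating family of real diagonal matrices `L_k`, the ground space of the
Lieb matrix is a line spanned by `vec W₀` with `W₀` positive definite (existence from
`Matrix.groundSpace_ne_bot`, positivity and uniqueness from
`IsLiebSystem.exists_posDef_eq_smul` / `IsLiebSystem.exists_eq_smul` of `LiebSpinReflection`). Lieb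
applies it with `X` = `n`-point subsets, `T = K`, `L_x` the site occupations, `U < 0` (Theorem 1),
resp. `-U < 0` after the hole–particle transformation (Theorem 2). [cite: LiebPRL1989, proof of Theorem 1(b)] -/
theorem exists_posDef_groundState_unique [Nonempty X] {T : Matrix X X ℂ} (hT : T.IsHermitian ∧ T.IsSymm)
    {U : ℝ} (hU : U < 0) {L : K → X → ℝ} (hsep : ∀ a b : X, a ≠ b → ∃ k, L k a ≠ L k b)
    (hconn : ∀ S : Set X, (∃ a, a ∈ S) → (∃ b, b ∉ S) → ∃ a ∈ S, ∃ b ∉ S, T a b ≠ 0) :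
    ∃ W₀ : Matrix X X ℂ, W₀.PosDef ∧ vec W₀ ∈ (liebMatrix T L U).groundSpace ∧
      ∀ v ∈ (liebMatrix T L U).groundSpace, ∃ c : ℂ, v = c • vec W₀ := by
  have sys := isLiebSystem hT hU hsep hconn
  obtain ⟨v, hv, hv0⟩ := (Submodule.ne_bot_iff _).1
    (Matrix.groundSpace_ne_bot_holds (liebMatrix_isHermitian hT.1 L U))
  obtain ⟨W, rfl⟩ := vec_bijective.surjective v
  have hW : Literature.MathematicalPhysics.QuantumLattice.liebOp T (fun k => rdiag (L k)) U W = ((liebMatrix T L U).groundEnergy : ℂ) • W :=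
    (mem_groundSpace_iff_liebOp hT.2 L U W).1 hv
  have hW0 : W ≠ 0 := fun h => hv0 (by rw [h, vec_zero])
  obtain ⟨P, hP, hPgs, -⟩ := sys.exists_posDef_eq_smul hW hW0
  refine ⟨P, hP, (mem_groundSpace_iff_liebOp hT.2 L U P).2 hPgs, fun u hu => ?_⟩
  obtain ⟨W', rfl⟩ := vec_bijective.surjective u
  have hW' := (mem_groundSpace_iff_liebOp hT.2 L U W').1 hu
  have hP0 : P ≠ 0 := by
    intro h
    have := hP.diag_pos (i := Classical.arbitrary X)
    rw [h] at this
    exact lt_irrefl _ this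
  obtain ⟨c, hc⟩ := sys.exists_eq_smul hPgs hW' hP0
  exact ⟨c, by rw [hc, vec_smul]⟩

end Literature.MathematicalPhysics.QuantumLattice.SpinReflection
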